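import Summits.ABC.IUTFork.Joshi.TestUntiltsFrobeniusLine
import Summits.ABC.IUTFork.Cor312PinnedCountermodel
import Summits.ABC.IUTFork.Cor312CheckBGluedScaledNonVacuity
import HarnessLib

/-!
# Branch-E TEST (abc-iut-E-t1, [J-I] carrier owner): the re-typed [J-I] residual at the PINNED countermodel — `MovesAreInd ∧ DatumEquivariant`
# excludes EVERY faithful volume read-out there (S false) — and the packaged contrast with X-07′ (S true): the residual CO-VARIES with `S`

Test file of the abc-iut cell, branch E (seat abc-iut-E-t1; lane (1) «[J-I] cluster vs S» of abc-iut-E-cx-3; rung LADDER-ABC:A2.E; R14 Test*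
file). PROOF-ONLY (0 `def`) over landed files imported BY NAME: this seat's `DictionaryUntiltsReadout` (p438244: `ExponentReadout`,
`ExponentLogFaithful`, `not_movesAreInd_and_datumEquivariant_of_readout`), `UntiltFrobeniusLine` (p438828: `frobLine`, `frobLine_actionDilates`),
`TestUntiltsFrobeniusLine` (the X-07′ side: `FrobLine.scalDictionary`, `frobLine_scal_fills`), the pinned model of record (p419720:
`pinnedSetting_thetaPinned`, `pinnedSetting_not_pilotKummerIndRelated`; `naiveData_adm_iff_image`, `naiveData_logvolInvariant`). TAKES NO SIDE
on [IUTchIII] Cor. 3.12 or on any author; typed ≠ proved ≠ endorsed.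

WHAT IS PROVED (standard axioms).
* §1 AT THE PINNED COUNTERMODEL (`naiveFull q` / `pinnedSetting q` / `orbitRegion q`, S FALSE; (Ind1)/(Ind2) act by signs and are
  volume-INVARIANT): for EVERY dilating points-signature and EVERY ball-valued reading, `MovesAreInd ∧ DatumEquivariant` excludes EVERY
  faithful read-out (`pinned_not_movesAreInd_and_datumEquivariant_of_readout`, `pinned_not_exponentReadout_of_movesAreInd`,
  `pinned_not_exponentLogFaithful_of_movesAreInd` — p438244's generalised location instantiated BY NAME; abc-iut-E-cx-3's TestUntiltsPinned §6
  is the linear case); non-vacuously on the Frobenius line (`frobLine_pinned_not_exponentReadout`).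
* §2 THE LABEL PROFILE of the X-07′ dictionary (proof-only, for E-plan/E-cx-3's repair of the residual): `FrobLine.logvol_scalDatum` — at EVERY
  label `j ∈ 𝔽_l^⋆` the read log-volume is `((j²−1)·log q/log b)·log(exponent y) − j²·log q` (slope ∝ `j² − 1`: ZERO at the label `1`, `3×`
  at the label `2` — Joshi's `j²`-law, [J-IIp] Thm 6.9.1 / Prop 7.4.4, as E-t41's `untiltFamily` reads it), and `FrobLine.logvol_scalDatum_ptAct`:
  along a move `σ` the label-`j` volume shifts by `(j² − 1)·v_q(σ 1)·log q` — for the Frobenius-like step `×q` exactly the Θ→q shift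
  `(j² − 1)·log q`. abc-iut-E-cx-3's countermodel #3 (even-power Ism, `TestUntiltsEvenScaling`) realises the κ-FREE, ONE-label sentence
  `ExponentLogFaithful` with a UNIFORM profile (slope `−2` at every label) where `S` is false: faithfulness of the read-out tracks the failure
  of `LogvolInvariant` (NECESSARY for `S`, X-06; NOT sufficient, countermodel #3), while `S` needs the profiled, q-pinned shifts `(1 − j²)`
  inside `⟨Ind⟩` (E-cx's index criterion) — which this dictionary has at X-07′ and the even-line dictionary lacks.
* §3 `frobLine_readout_two_models`: the packaged contrast over the TWO models of record — (i) at X-07′ a [J-I] dictionary has `MovesAreInd ∧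
  DatumEquivariant ∧ ExponentLogFaithful`, `S` HOLDS (derived through it) and `LogvolInvariant` FAILS; (ii) at the pinned model every
  ball-valued dictionary with `MovesAreInd ∧ DatumEquivariant` has NO faithful read-out, `LogvolInvariant` HOLDS and `S` FAILS. R13: the
  separating hypothesis between these two is `MRData.LogvolInvariant` BY NAME; by countermodel #3 this is a location of the read-out's
  REALISABILITY, not of `S`. Located, not adjudicated. [claim: Joshi2021ATS1, status: disputed]; our side [claim: Mochizuki2012, status: disputed].
-/

noncomputable section

open Set

namespace Summit.ABC.IUTFork.Joshi

open Summit.ABC.IUTFork.Thm311 Summit.ABC.IUTFork.Cor312 Summit.ABC.IUTFork.Cor312Vol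
open Cor312.Checks Cor312.IdentifiedNonVacuity NaiveWitness PinnedWitness IsmScaling

/-! ## 1. At the pinned countermodel: `MovesAreInd ∧ DatumEquivariant` excludes EVERY faithful read-out -/

section Pinned

variable {p : ℕ} [Fact p.Prime] {𝒪E : Type} [CommRing 𝒪E] (D : UntiltPoints p 𝒪E) (q : ℕ) [Fact q.Prime]
  {base std : D.Pt} (datum : D.Pt → ∀ v : toyIndex.V, v ∈ toyIndex.Vbad → Set ((naiveFull q).L.StarPacket v))
  (real : D.Aut → (naiveFull q).L.PacketAut)

/-- **J-FALSE-AT-PINNED for «`MovesAreInd ∧ DatumEquivariant` ∧ ANY faithful read-out» on a dilating signature** (p438244's generalised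
location instantiated BY NAME at the model of record p419720: `orbitRegion` is `⟨(Ind1) ∪ (Ind2)⟩`-equivariant (`pinnedSetting_thetaPinned`),
the sign generators preserve admissibility (`naiveData_adm_iff_image`) and log-volume (`naiveData_logvolInvariant`)). TestUntiltsPinned §6
(E-cx-3) is the linear case. [claim: Joshi2021ATS1, status: disputed] -/
theorem pinned_not_movesAreInd_and_datumEquivariant_of_readout (hDil : D.ActionDilates)
    (hadm : ∀ (y : D.Pt) (j : toyIndex.Label) (vQ : toyIndex.VQ),
      ((naiveFull q).toLatticeSituation.D (pinnedSetting q).n).Adm j vQ (orbitRegion q (datum y) j vQ))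
    (hX : UntiltPoints.ExponentReadout D (naiveFull q).toLatticeSituation (pinnedSetting q).n (orbitRegion q) datum) :
    ¬ (MovesAreInd (D.toDictionary (naiveFull q).toLatticeSituation base std datum real) ∧
        DatumEquivariant (D.toDictionary (naiveFull q).toLatticeSituation base std datum real)) :=
  UntiltPoints.not_movesAreInd_and_datumEquivariant_of_readout (S := (naiveFull q).toLatticeSituation) (pinnedSetting q).n
    (orbitRegion q) (pinnedSetting_thetaPinned q).1 (naiveData_adm_iff_image q) (naiveData_logvolInvariant q) hadm hX hDil

/-- The same as a dichotomy: at the pinned model, Y₁'s two load-bearing components make every ball-valued reading of a dilating signature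
exponent-UNfaithful for EVERY read-out (in particular the logarithmic one that X-07′ realises). [claim: Joshi2021ATS1, status: disputed] -/
theorem pinned_not_exponentReadout_of_movesAreInd (hDil : D.ActionDilates)
    (hadm : ∀ (y : D.Pt) (j : toyIndex.Label) (vQ : toyIndex.VQ),
      ((naiveFull q).toLatticeSituation.D (pinnedSetting q).n).Adm j vQ (orbitRegion q (datum y) j vQ))
    (hM : MovesAreInd (D.toDictionary (naiveFull q).toLatticeSituation base std datum real))
    (hE : DatumEquivariant (D.toDictionary (naiveFull q).toLatticeSituation base std datum real)) :
    ¬ UntiltPoints.ExponentReadout D (naiveFull q).toLatticeSituation (pinnedSetting q).n (orbitRegion q) datum := fun hX =>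
  pinned_not_movesAreInd_and_datumEquivariant_of_readout D q datum real hDil hadm hX ⟨hM, hE⟩

/-- … hence also not log-faithful. [claim: Joshi2021ATS1, status: disputed] -/
theorem pinned_not_exponentLogFaithful_of_movesAreInd (hDil : D.ActionDilates)
    (hadm : ∀ (y : D.Pt) (j : toyIndex.Label) (vQ : toyIndex.VQ),
      ((naiveFull q).toLatticeSituation.D (pinnedSetting q).n).Adm j vQ (orbitRegion q (datum y) j vQ))
    (hM : MovesAreInd (D.toDictionary (naiveFull q).toLatticeSituation base std datum real))
    (hE : DatumEquivariant (D.toDictionary (naiveFull q).toLatticeSituation base std datum real)) :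
    ¬ UntiltPoints.ExponentLogFaithful D (naiveFull q).toLatticeSituation (pinnedSetting q).n (orbitRegion q) datum := fun hX =>
  pinned_not_exponentReadout_of_movesAreInd D q datum real hDil hadm hM hE
    (UntiltPoints.exponentReadout_of_exponentLogFaithful (S := (naiveFull q).toLatticeSituation) (pinnedSetting q).n
      (orbitRegion q) hX)

end Pinned

section PinnedFrobLine

variable (p q : ℕ) [Fact p.Prime] [Fact q.Prime] (b : ℝ) (hb : 0 < b)

/-- NON-VACUOUSLY on the Frobenius line (`frobLine_actionDilates` BY NAME): at the pinned model no ball-valued equivariant reading inside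
`⟨(Ind1) ∪ (Ind2)⟩` of the Frobenius-line structures has a faithful volume read-out — while S FAILS there (p419720
`pinnedSetting_not_pilotKummerIndRelated`, BY NAME). [claim: Joshi2021ATS1, status: disputed] -/
theorem frobLine_pinned_not_exponentReadout (hb1 : b ≠ 1) {base std : (frobLine p q b hb).Pt}
    (datum : (frobLine p q b hb).Pt → ∀ v : toyIndex.V, v ∈ toyIndex.Vbad → Set ((naiveFull q).L.StarPacket v))
    (real : (frobLine p q b hb).Aut → (naiveFull q).L.PacketAut)
    (hadm : ∀ (y : (frobLine p q b hb).Pt) (j : toyIndex.Label) (vQ : toyIndex.VQ),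
      ((naiveFull q).toLatticeSituation.D (pinnedSetting q).n).Adm j vQ (orbitRegion q (datum y) j vQ))
    (hM : MovesAreInd ((frobLine p q b hb).toDictionary (naiveFull q).toLatticeSituation base std datum real))
    (hE : DatumEquivariant ((frobLine p q b hb).toDictionary (naiveFull q).toLatticeSituation base std datum real)) :
    ¬ UntiltPoints.ExponentReadout (frobLine p q b hb) (naiveFull q).toLatticeSituation (pinnedSetting q).n (orbitRegion q) datum ∧
      ¬ PilotKummerIndRelated (naiveFull q).toLatticeSituation (pinnedSetting q) (orbitRegion q) (qDatum q) :=
  ⟨pinned_not_exponentReadout_of_movesAreInd _ q datum real (frobLine_actionDilates b hb hb1) hadm hM hE,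
    pinnedSetting_not_pilotKummerIndRelated q⟩

end PinnedFrobLine

/-! ## 2. The label profile of the X-07′ dictionary: Joshi's `j²`-law, pinned to the q-unit -/

namespace FrobLine

variable (q : ℕ) [hq : Fact q.Prime] (p : ℕ) [Fact p.Prime] (b : ℝ) (hb : 0 < b)

/-- **The full label profile.** At EVERY label `j ∈ 𝔽_l^⋆` the read log-volume of the datum of `y` is
`((j² − 1)·log q / log b)·log(exponent y) − j²·log q`: the slope in `log(exponent)` is proportional to `j² − 1` — ZERO at the label `1` (the
region there is `B_1 = q·𝒪` for every structure), `3·log q/log b` at the label `2` — and the unit is the q-parameter's: one Frobenius-like step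
(`exponent ↦ b·exponent`) shifts the label-`j` volume by exactly `(j² − 1)·log q`. [claim: Joshi2021ATS1, status: disputed] -/
theorem logvol_scalDatum (hb1 : b ≠ 1) {j : toyIndex.Label} (hj : j ≠ 0) (vQ : toyIndex.VQ) (y : (frobLine p q b hb).Pt) :
    ((scalFull q).toLatticeSituation.D (scalSetting q).n).logvol j vQ (scalRegion q (scalDatum q y) j vQ) =
      ((jsq j : ℝ) - 1) * Real.log q / Real.log b * Real.log ((frobLine p q b hb).exponent y) - (jsq j : ℝ) * Real.log q := by
  have hlogb : Real.log b ≠ 0 := Real.log_ne_zero_of_pos_of_ne_one hb hb1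
  induction y using Quotient.inductionOn with
  | h g =>
    show pVol q j vQ (scalRegion q (scalDatum q (Quotient.mk (unitRel ℤ ℚ) g)) j vQ) = _
    rw [scalRegion_scalDatum_mk q hj, pVol_pBall, exponent_frobLine, idx_mk, Real.log_zpow]
    push_cast
    field_simp
    ring

/-- **The shift along a move is `(j² − 1)·v_q(σ 1)·log q` at the label `j`** (label-DEPENDENT, in q-units): for the Frobenius-like step `×q`
(`v_q(σ 1) = 1`) this is the Θ→q shift `(j² − 1)·log q` at every label simultaneously — what E-t41's `untiltFamily` does and what a
UNIFORM translation (abc-iut-E-cx-3's even-line dictionary: `−2·log q` at every label) does not. [claim: Joshi2021ATS1, status: disputed] -/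
theorem logvol_scalDatum_ptAct (hb1 : b ≠ 1) {j : toyIndex.Label} (hj : j ≠ 0) (vQ : toyIndex.VQ) (σ : (frobLine p q b hb).Aut)
    (y : (frobLine p q b hb).Pt) :
    ((scalFull q).toLatticeSituation.D (scalSetting q).n).logvol j vQ (scalRegion q (scalDatum q ((frobLine p q b hb).ptAct σ y)) j vQ) =
      ((scalFull q).toLatticeSituation.D (scalSetting q).n).logvol j vQ (scalRegion q (scalDatum q y) j vQ) +
        ((jsq j : ℝ) - 1) * (padicValRat q (σ.toLinearEquiv (1 : ℚ)) : ℝ) * Real.log q := by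
  have hlogb : Real.log b ≠ 0 := Real.log_ne_zero_of_pos_of_ne_one hb hb1
  rw [logvol_scalDatum q p b hb hb1 hj, logvol_scalDatum q p b hb hb1 hj, exponent_ptAct_frobLine,
    Real.log_mul (zpow_pos hb _).ne' ((frobLine p q b hb).exponent_pos y).ne', Real.log_zpow]
  field_simp
  ring

/-- In particular for the step `×q`: the label-`j` volume drops by exactly `(j² − 1)·log q` (Θ-region `B_{j²}` ↦ q-region `B_1`).
[claim: Joshi2021ATS1, status: disputed] -/
theorem logvol_scalDatum_mulAut_q (hb1 : b ≠ 1) {j : toyIndex.Label} (hj : j ≠ 0) (vQ : toyIndex.VQ) (y : (frobLine p q b hb).Pt) :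
    ((scalFull q).toLatticeSituation.D (scalSetting q).n).logvol j vQ
        (scalRegion q (scalDatum q ((frobLine p q b hb).ptAct (mulAut b hb (q : ℚ) (Nat.cast_ne_zero.2 hq.out.ne_zero)) y)) j vQ) =
      ((scalFull q).toLatticeSituation.D (scalSetting q).n).logvol j vQ (scalRegion q (scalDatum q y) j vQ) +
        ((jsq j : ℝ) - 1) * Real.log q := by
  rw [logvol_scalDatum_ptAct q p b hb hb1 hj, mulAut_toLinearEquiv_one, padicValRat.self hq.out.one_lt]
  push_cast
  ring

end FrobLine

/-! ## 3. The packaged contrast: the re-typed residual co-varies with `S` -/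

section Covaries

variable (p q : ℕ) [Fact p.Prime] [hq : Fact q.Prime] (b : ℝ) (hb : 0 < b)

/-- **THE RE-TYPED [J-I] RESIDUAL AT THE TWO MODELS OF RECORD.** On ONE dilating [J-I] points-signature (the Frobenius line): (i) at the
X-07′ instantiation ((Ind2) ∋ `x ↦ q·x`, volume-NON-invariant) a [J-I] dictionary has `MovesAreInd ∧ DatumEquivariant ∧ ExponentLogFaithful`
and `S` HOLDS (derived through it); (ii) at the pinned countermodel ((Ind1)/(Ind2) by signs, volume-invariant) EVERY ball-valued dictionary
with `MovesAreInd ∧ DatumEquivariant` has NO faithful read-out, and `S` FAILS. The located hypothesis separating the two is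
`MRData.LogvolInvariant` BY NAME — a location of the read-out's REALISABILITY (necessary for `S`), not of `S`: abc-iut-E-cx-3's countermodel #3
(even-power Ism) realises the κ-free one-label read-out where `S` is false; the S-sufficient content is the label profile of §2 inside
`⟨Ind⟩`. Located, not adjudicated. [claim: Joshi2021ATS1, status: disputed] -/
theorem frobLine_readout_two_models (hb1 : b ≠ 1) :
    (MovesAreInd (FrobLine.scalDictionary q p b hb) ∧ DatumEquivariant (FrobLine.scalDictionary q p b hb) ∧
        UntiltPoints.ExponentLogFaithful (frobLine p q b hb) (scalFull q).toLatticeSituation (scalSetting q).n (scalRegion q)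
          (FrobLine.scalDatum q) ∧
        PilotKummerIndRelated (scalFull q).toLatticeSituation (scalSetting q) (scalRegion q) (qDatum q) ∧
        ¬ ((scalFull q).D (scalSetting q).n).LogvolInvariant) ∧
      (∀ {base std : (frobLine p q b hb).Pt}
        (datum : (frobLine p q b hb).Pt → ∀ v : toyIndex.V, v ∈ toyIndex.Vbad → Set ((naiveFull q).L.StarPacket v))
        (real : (frobLine p q b hb).Aut → (naiveFull q).L.PacketAut),
        (∀ (y : (frobLine p q b hb).Pt) (j : toyIndex.Label) (vQ : toyIndex.VQ),
          ((naiveFull q).toLatticeSituation.D (pinnedSetting q).n).Adm j vQ (orbitRegion q (datum y) j vQ)) →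
        MovesAreInd ((frobLine p q b hb).toDictionary (naiveFull q).toLatticeSituation base std datum real) →
        DatumEquivariant ((frobLine p q b hb).toDictionary (naiveFull q).toLatticeSituation base std datum real) →
        ¬ UntiltPoints.ExponentReadout (frobLine p q b hb) (naiveFull q).toLatticeSituation (pinnedSetting q).n (orbitRegion q) datum) ∧
      ((naiveFull q).D (pinnedSetting q).n).LogvolInvariant ∧
      ¬ PilotKummerIndRelated (naiveFull q).toLatticeSituation (pinnedSetting q) (orbitRegion q) (qDatum q) :=
  ⟨⟨FrobLine.movesAreInd_scal q p b hb, FrobLine.datumEquivariant_scal q p b hb, FrobLine.exponentLogFaithful_scal q p b hb hb1,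
      FrobLine.scal_pilotKummerIndRelated_of_frobLine q p b hb, scalSetting_not_logvolInvariant q⟩,
    fun datum real hadm hM hE =>
      pinned_not_exponentReadout_of_movesAreInd _ q datum real (frobLine_actionDilates b hb hb1) hadm hM hE,
    naiveData_logvolInvariant q, pinnedSetting_not_pilotKummerIndRelated q⟩

end Covaries

end Summit.ABC.IUTFork.Joshi

end
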